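import Summits.CriticalPhenomena.SAWScalingLimit.Theses.SAWAsymptoticMorera

/-!
# Line `birth` — registered skeleton for the crux `InteriorRegularity` (stmt-CriticalPhenomena-6857)

Crux (FIXED; rank 3 of `route-CriticalPhenomena-SAWAsymptoticMorera`, decl
`Summit.CriticalPhenomena.SAWScalingLimit.Theses.SAWAsymptoticMorera.InteriorRegularity`): for the critical
square-lattice mid-edge parafermionic observable `F_δ` (σ = 5/8, x = x_c, rooted at a boundary vertex
`a_δ → a = D.pt 0` with outside reference neighbour `a'_δ`) and every compact `K ⊆ Ω` with non-empty
interior: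

* (E) SUP-RELATIVE EQUICONTINUITY ON `K`: `∀ ε > 0 ∃ η > 0`, eventually in `δ → 0⁺`, medial points of `K` at
  distance `≤ η` carry values of `F_δ` differing by `≤ ε · S_K(δ)`, `S_K(δ) = sup_{m_e ∈ K} |F_δ(e)|`;
* (H) HARNACK COMPARABILITY: for every other fat compact `K' ⊆ Ω` there is `C` with `S_K(δ) ≤ C · S_{K'}(δ)`
  eventually.

## The cut (the route header's TWO-LAYER PLAN "InteriorRegularity ⇐ HarnackComparability → SupEquicontinuity",
## with the equicontinuity piece put in the LOCAL form an interior estimate actually delivers)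

* S1 `stub_harnackComparability` — (H) for every ordered pair of fat compacts of `Ω` (clause (ii) of the crux,
  verbatim up to currying). A doubling / Harnack-chain statement for `|F_δ|`: no fat compact carries
  asymptotically more sup-mass than any other. Plausibly true because `F_δ` is a positive combination of SAW
  generating functions twisted by a bounded phase, and SAW two-point functions in the bulk of a domain at
  `x_c` are comparable on macroscopic scales (Hammersley–Welsh / sub-ballisticity inputs,
  DuminilCopinHammond2013; mass comparisons as in LawlerSchrammWerner2004SAW §3); it is exactly what fails if
  `|F_δ|` concentrates. Size L–XL (open).
* S2 `stub_localSupEquicontinuity` — LOCAL SUP-EQUICONTINUITY: for compacts `K ⊆ interior K₁`, `K₁ ⊆ Ω`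
  compact, the modulus of continuity of `F_δ` on `K` is `o(1) · S_{K₁}(δ)` — oscillation on `K` is controlled
  by the sup over a compact NEIGHBOURHOOD `K₁`, the shape every interior estimate has (discrete
  Cauchy/Caccioppoli: Morera-with-remainder on mesoscopic contours around pairs of nearby medial points, the
  remainder being the smeared vertex defect of `Z2VertexIdentity`; cf. the continuity Ikhlef–Cardy say Morera
  needs, IkhlefCardy2009 §1, and the s-holomorphic regularity theory of ChelkakSmirnov2012 §3 which this
  replaces on ℤ² where no exact relation exists). It also carries the isotropy content flagged by the refuter
  (mixed edge orientations are compared). Size XL (open; the load-bearing stub).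

`InteriorRegularity_of` (kernel-checked, no `sorry` of its own) is NOT a conjunction seam: given a fat compact
`K ⊆ Ω` it builds a compact neighbourhood `K₁ = cthickening r K ⊆ Ω` (`Ω` is open:
`IsCompact.exists_cthickening_subset_open`; `K ⊆ thickening r K ⊆ interior K₁`; `K₁` fat because `K` is),
runs S1 on the pair `(K₁, K)` to get `S_{K₁} ≤ C · S_K` eventually, replaces `C` by `max C 1 > 0`, feeds
`ε / max C 1` to S2 and chains the two eventualities: `|F_δ(e) − F_δ(e')| ≤ (ε / C') S_{K₁} ≤ ε S_K`.
Clause (H) of the crux is S1 itself. Conversely both stubs FOLLOW from the crux ((H) is its clause (ii);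
S2 is clause (i) at `K₁` restricted to pairs in `K`), so the pair {S1, S2} is equivalent to the crux: the cut
loses nothing and neither piece alone is the crux (S1 has no continuity content, S2 no comparison of distant
compacts) — BC3 probes `stub → InteriorRegularity`, `stub → SAWScalingLimit` fail for both (folder `bc/`).

No `Disproof.lean` exists for this crux (`ledger crux ls stmt-CriticalPhenomena-6857`: no workfiles,
2026-08-17); negatives index checked (11 entries, none an interior-regularity statement). Hypotheses of
`InteriorRegularity_of` are the two stubs under their registered names (`__Registered.stub_…`, the device of
`Cruxes/AxiomsOfLimit/Lines/birth.lean`: the skeleton audit admits a hypothesis only by registered stub NAME;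
`@[stub]` is gate-reserved); its conclusion is the route decl BY NAME.
-/

noncomputable section

open scoped Classical
open Filter Topology Set
open Literature.Probability.RandomPlanarGeometry Literature.Probability.LatticeModels

namespace Summit.CriticalPhenomena.SAWScalingLimit.Cruxes.InteriorRegularity.Birth

/-! ### Vocabulary of the line: the two pieces as named statements

Both are stated over exactly the objects of the crux (same `let`-chain: half-edge generating function `H`,
mid-edge observable `F`, medial point `m`, compact-restricted sup `S`), root hypotheses verbatim. -/

/-- **S1, named.** Harnack comparability of the sups of `|F_δ|` over any two fat compacts of `Ω`
(clause (ii) of the crux, curried). -/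
def HarnackComparability : Prop :=
  ∀ (D : DobrushinDomain) (a a' : ℝ → Site 2),
  let H : ℝ → Site 2 → Site 2 → ℂ := fun δ p q =>
    ∑' γ : SAW.DomainSAW D.carrier δ (a δ) p,
      if s(p, q) ∈ γ.walk.edges then 0 else
        Complex.exp (-Complex.I * (5 / 8 : ℂ) *
          (winding (meshPoint δ (a' δ) :: (γ.walk.support.map (meshPoint δ)) ++ [medialPoint δ s(p, q)]) : ℝ)) *
        (SAW.criticalFugacity : ℂ) ^ (γ.length + 1);
  let dir : Fin 2 → Site 2 := ![![1, 0], ![0, 1]];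
  let F : ℝ → Site 2 × Fin 2 → ℂ := fun δ e => H δ e.1 (e.1 + dir e.2) + H δ (e.1 + dir e.2) e.1;
  let m : ℝ → Site 2 × Fin 2 → ℂ := fun δ e => medialPoint δ s(e.1, e.1 + dir e.2);
  let S : Set ℂ → ℝ → ℝ := fun K δ => ⨆ e : Site 2 × Fin 2, (if m δ e ∈ K then ‖F δ e‖ else 0);
  (∀ᶠ δ in nhdsWithin 0 (Set.Ioi 0),
      a δ ∈ meshDomain D.carrier δ ∧ (zdGraph 2).Adj (a δ) (a' δ) ∧ meshPoint δ (a' δ) ∉ D.carrier) →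
  Filter.Tendsto (fun δ => meshPoint δ (a δ)) (nhdsWithin 0 (Set.Ioi 0)) (nhds (D.pt 0)) →
  ∀ K K' : Set ℂ, IsCompact K → K ⊆ D.carrier → (interior K).Nonempty →
    IsCompact K' → K' ⊆ D.carrier → (interior K').Nonempty →
    ∃ C : ℝ, ∀ᶠ δ in nhdsWithin 0 (Set.Ioi 0), S K δ ≤ C * S K' δ

/-- **S2, named.** Local sup-equicontinuity: on a compact `K` sitting in the interior of a compact
`K₁ ⊆ Ω`, the modulus of continuity of `F_δ` is `o(1)` times the sup of `|F_δ|` over `K₁`. -/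
def LocalSupEquicontinuity : Prop :=
  ∀ (D : DobrushinDomain) (a a' : ℝ → Site 2),
  let H : ℝ → Site 2 → Site 2 → ℂ := fun δ p q =>
    ∑' γ : SAW.DomainSAW D.carrier δ (a δ) p,
      if s(p, q) ∈ γ.walk.edges then 0 else
        Complex.exp (-Complex.I * (5 / 8 : ℂ) *
          (winding (meshPoint δ (a' δ) :: (γ.walk.support.map (meshPoint δ)) ++ [medialPoint δ s(p, q)]) : ℝ)) *
        (SAW.criticalFugacity : ℂ) ^ (γ.length + 1);
  let dir : Fin 2 → Site 2 := ![![1, 0], ![0, 1]];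
  let F : ℝ → Site 2 × Fin 2 → ℂ := fun δ e => H δ e.1 (e.1 + dir e.2) + H δ (e.1 + dir e.2) e.1;
  let m : ℝ → Site 2 × Fin 2 → ℂ := fun δ e => medialPoint δ s(e.1, e.1 + dir e.2);
  let S : Set ℂ → ℝ → ℝ := fun K δ => ⨆ e : Site 2 × Fin 2, (if m δ e ∈ K then ‖F δ e‖ else 0);
  (∀ᶠ δ in nhdsWithin 0 (Set.Ioi 0),
      a δ ∈ meshDomain D.carrier δ ∧ (zdGraph 2).Adj (a δ) (a' δ) ∧ meshPoint δ (a' δ) ∉ D.carrier) →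
  Filter.Tendsto (fun δ => meshPoint δ (a δ)) (nhdsWithin 0 (Set.Ioi 0)) (nhds (D.pt 0)) →
  ∀ K K₁ : Set ℂ, IsCompact K → IsCompact K₁ → K ⊆ interior K₁ → K₁ ⊆ D.carrier →
    ∀ ε > 0, ∃ η > 0, ∀ᶠ δ in nhdsWithin 0 (Set.Ioi 0), ∀ e e' : Site 2 × Fin 2,
      m δ e ∈ K → m δ e' ∈ K → ‖m δ e - m δ e'‖ ≤ η → ‖F δ e - F δ e'‖ ≤ ε * S K₁ δ

/-! ### The stubs (the ONLY `sorry`s of this file)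

Each stub is stated over TREE VOCABULARY ONLY (the named statements above written out), so that it lands
verbatim as `Theorems/SAWAsymptoticMoreraInteriorRegularity<Stub>.lean --supports stmt-CriticalPhenomena-6857`
without importing this workfile (`open Literature.Probability.RandomPlanarGeometry
Literature.Probability.LatticeModels` for the short names); the `*_holds` theorems below certify
definitionally that the written-out text IS the named statement. -/

/-- **S1 — Harnack comparability of sup-masses over fat compacts.** For the critical ℤ² mid-edge
parafermionic observable rooted at `a_δ → D.pt 0` (reference neighbour `a'_δ` outside `Ω`) and any two
compacts `K, K' ⊆ Ω` with non-empty interiors there is `C` with `sup_K |F_δ| ≤ C · sup_{K'} |F_δ|` for all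
small `δ`. The `|F_δ|`-mass cannot concentrate on one fat compact and starve another: a Harnack-chain /
doubling statement for the twisted SAW generating functions. -/
theorem stub_harnackComparability :
    ∀ (D : DobrushinDomain) (a a' : ℝ → Site 2),
    let H : ℝ → Site 2 → Site 2 → ℂ := fun δ p q =>
      ∑' γ : SAW.DomainSAW D.carrier δ (a δ) p,
        if s(p, q) ∈ γ.walk.edges then 0 else
          Complex.exp (-Complex.I * (5 / 8 : ℂ) *
            (winding (meshPoint δ (a' δ) :: (γ.walk.support.map (meshPoint δ)) ++ [medialPoint δ s(p, q)]) : ℝ)) *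
          (SAW.criticalFugacity : ℂ) ^ (γ.length + 1);
    let dir : Fin 2 → Site 2 := ![![1, 0], ![0, 1]];
    let F : ℝ → Site 2 × Fin 2 → ℂ := fun δ e => H δ e.1 (e.1 + dir e.2) + H δ (e.1 + dir e.2) e.1;
    let m : ℝ → Site 2 × Fin 2 → ℂ := fun δ e => medialPoint δ s(e.1, e.1 + dir e.2);
    let S : Set ℂ → ℝ → ℝ := fun K δ => ⨆ e : Site 2 × Fin 2, (if m δ e ∈ K then ‖F δ e‖ else 0);
    (∀ᶠ δ in nhdsWithin 0 (Set.Ioi 0),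
        a δ ∈ meshDomain D.carrier δ ∧ (zdGraph 2).Adj (a δ) (a' δ) ∧ meshPoint δ (a' δ) ∉ D.carrier) →
    Filter.Tendsto (fun δ => meshPoint δ (a δ)) (nhdsWithin 0 (Set.Ioi 0)) (nhds (D.pt 0)) →
    ∀ K K' : Set ℂ, IsCompact K → K ⊆ D.carrier → (interior K).Nonempty →
      IsCompact K' → K' ⊆ D.carrier → (interior K').Nonempty →
      ∃ C : ℝ, ∀ᶠ δ in nhdsWithin 0 (Set.Ioi 0), S K δ ≤ C * S K' δ := by
  sorry

/-- **S2 (hardest) — local sup-equicontinuity relative to a compact neighbourhood.** For the same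
observable and compacts `K ⊆ interior K₁`, `K₁ ⊆ Ω` compact: `∀ ε > 0 ∃ η > 0`, for all small `δ`, any two
edges with medial points in `K` at distance `≤ η` (ANY orientations — this contains the isotropy statement
`F_δ(horizontal) − F_δ(vertical) = o(sup)`) satisfy `|F_δ(e) − F_δ(e')| ≤ ε · sup_{K₁} |F_δ|`. The shape an
interior estimate delivers (discrete Cauchy formula with remainder on mesoscopic contours, the remainder
being the smeared ℤ² vertex defect); no harmonicity / FKG / exact s-holomorphicity is available. -/
theorem stub_localSupEquicontinuity :
    ∀ (D : DobrushinDomain) (a a' : ℝ → Site 2),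
    let H : ℝ → Site 2 → Site 2 → ℂ := fun δ p q =>
      ∑' γ : SAW.DomainSAW D.carrier δ (a δ) p,
        if s(p, q) ∈ γ.walk.edges then 0 else
          Complex.exp (-Complex.I * (5 / 8 : ℂ) *
            (winding (meshPoint δ (a' δ) :: (γ.walk.support.map (meshPoint δ)) ++ [medialPoint δ s(p, q)]) : ℝ)) *
          (SAW.criticalFugacity : ℂ) ^ (γ.length + 1);
    let dir : Fin 2 → Site 2 := ![![1, 0], ![0, 1]];
    let F : ℝ → Site 2 × Fin 2 → ℂ := fun δ e => H δ e.1 (e.1 + dir e.2) + H δ (e.1 + dir e.2) e.1;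
    let m : ℝ → Site 2 × Fin 2 → ℂ := fun δ e => medialPoint δ s(e.1, e.1 + dir e.2);
    let S : Set ℂ → ℝ → ℝ := fun K δ => ⨆ e : Site 2 × Fin 2, (if m δ e ∈ K then ‖F δ e‖ else 0);
    (∀ᶠ δ in nhdsWithin 0 (Set.Ioi 0),
        a δ ∈ meshDomain D.carrier δ ∧ (zdGraph 2).Adj (a δ) (a' δ) ∧ meshPoint δ (a' δ) ∉ D.carrier) →
    Filter.Tendsto (fun δ => meshPoint δ (a δ)) (nhdsWithin 0 (Set.Ioi 0)) (nhds (D.pt 0)) →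
    ∀ K K₁ : Set ℂ, IsCompact K → IsCompact K₁ → K ⊆ interior K₁ → K₁ ⊆ D.carrier →
      ∀ ε > 0, ∃ η > 0, ∀ᶠ δ in nhdsWithin 0 (Set.Ioi 0), ∀ e e' : Site 2 × Fin 2,
        m δ e ∈ K → m δ e' ∈ K → ‖m δ e - m δ e'‖ ≤ η → ‖F δ e - F δ e'‖ ≤ ε * S K₁ δ := by
  sorry

/-! ### Consistency: each named statement IS its registered stub (definitionally) -/

theorem harnackComparability_holds : HarnackComparability := stub_harnackComparability
theorem localSupEquicontinuity_holds : LocalSupEquicontinuity := stub_localSupEquicontinuity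

/-! ### Name-keyed aliases of the two statements — the hypotheses of `InteriorRegularity_of`

The native skeleton audit (`#h21_check_skeleton`) admits a hypothesis of the skeleton theorem only if its head
constant is a registered obligation or is NAMED like a declared stub; `__Registered.stub_X` is the statement of
`stub_X` under that name (the `__` namespace is an implementation detail, so the audit's stub report resolves
each `stub_…` to the sorried theorem, not to the alias). Each alias is `rfl`-equal to its statement. -/
namespace __Registered

/-- Alias of `HarnackComparability` keyed by the registered stub name. -/
abbrev stub_harnackComparability : Prop := HarnackComparability
/-- Alias of `LocalSupEquicontinuity` keyed by the registered stub name. -/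
abbrev stub_localSupEquicontinuity : Prop := LocalSupEquicontinuity

end __Registered

/-! ### The skeleton theorem: the two stubs imply the crux, BY NAME -/

/-- **`InteriorRegularity` from the line `birth`** (kernel-checked, no `sorry` of its own). Clause (H) of the
crux is S1. Clause (E): `Ω = D.carrier` is open, so the fat compact `K` has a compact neighbourhood
`K₁ = cthickening r K ⊆ Ω` with `K ⊆ thickening r K ⊆ interior K₁` and `interior K₁ ⊇ interior K ≠ ∅`;
S1 on the pair `(K₁, K)` gives `S K₁ δ ≤ C · S K δ ≤ max C 1 · S K δ` eventually (`S K δ ≥ 0` as a supremum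
of non-negative reals), S2 with `ε / max C 1` gives the modulus of continuity on `K` relative to `S K₁ δ`, and
on the intersection of the two eventualities `‖F δ e − F δ e'‖ ≤ (ε / max C 1) · S K₁ δ ≤ ε · S K δ`. -/
theorem InteriorRegularity_of (hH : __Registered.stub_harnackComparability)
    (hE : __Registered.stub_localSupEquicontinuity) :
    Summit.CriticalPhenomena.SAWScalingLimit.Theses.SAWAsymptoticMorera.InteriorRegularity := by
  intro D a a' H dir F m S hroot ha K hK hKΩ hKint
  have hH' := hH D a a' hroot ha
  have hE' := hE D a a' hroot ha
  refine ⟨?_, fun K' hK' hK'Ω hK'int => hH' K K' hK hKΩ hKint hK' hK'Ω hK'int⟩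
  intro ε hε
  -- a compact neighbourhood `K₁ = cthickening r K` of `K` inside the open set `Ω`
  obtain ⟨r, hr, hrΩ⟩ := hK.exists_cthickening_subset_open D.isOpen hKΩ
  have hK₁ : IsCompact (Metric.cthickening r K) := hK.cthickening
  have hKK₁ : K ⊆ interior (Metric.cthickening r K) :=
    (Metric.self_subset_thickening hr K).trans
      (interior_maximal (Metric.thickening_subset_cthickening r K) Metric.isOpen_thickening)
  have hK₁int : (interior (Metric.cthickening r K)).Nonempty :=
    hKint.mono (interior_mono (Metric.self_subset_cthickening K))
  -- Harnack on the pair (K₁, K), constant normalised to be ≥ 1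
  obtain ⟨C, hC⟩ := hH' (Metric.cthickening r K) K hK₁ hrΩ hK₁int hK hKΩ hKint
  have hC'pos : (0 : ℝ) < max C 1 := lt_of_lt_of_le one_pos (le_max_right C 1)
  -- local equicontinuity on K relative to the sup over K₁, with ε / max C 1
  obtain ⟨η, hη, hev⟩ :=
    hE' K (Metric.cthickening r K) hK hK₁ hKK₁ hrΩ (ε / max C 1) (div_pos hε hC'pos)
  refine ⟨η, hη, ?_⟩
  filter_upwards [hev, hC] with δ hδ hδC e e' he he' hdist
  have hS0 : 0 ≤ S K δ := by
    apply Real.iSup_nonneg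
    intro i
    split_ifs
    · exact norm_nonneg _
    · exact le_rfl
  have h1 : ‖F δ e - F δ e'‖ ≤ ε / max C 1 * S (Metric.cthickening r K) δ := hδ e e' he he' hdist
  have h2 : S (Metric.cthickening r K) δ ≤ max C 1 * S K δ :=
    hδC.trans (mul_le_mul_of_nonneg_right (le_max_left C 1) hS0)
  calc ‖F δ e - F δ e'‖ ≤ ε / max C 1 * S (Metric.cthickening r K) δ := h1
    _ ≤ ε / max C 1 * (max C 1 * S K δ) := mul_le_mul_of_nonneg_left h2 (div_pos hε hC'pos).le
    _ = ε * S K δ := by rw [← mul_assoc, div_mul_cancel₀ ε hC'pos.ne']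

/-- Wiring check (an `example`, so that `InteriorRegularity_of` stays the only theorem concluding the crux):
the registered stubs, with their tree-vocabulary types, feed the skeleton theorem as stated — this term
becomes the crux proof when the two `sorry`s above are discharged. -/
example : Summit.CriticalPhenomena.SAWScalingLimit.Theses.SAWAsymptoticMorera.InteriorRegularity :=
  InteriorRegularity_of stub_harnackComparability stub_localSupEquicontinuity

end Summit.CriticalPhenomena.SAWScalingLimit.Cruxes.InteriorRegularity.Birth

end
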